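import Literature.AlgebraicGeometry.Resolution.RegularCentreBlowupOrder
import Literature.AlgebraicGeometry.Resolution.NearPointsRational
import Mathlib.RingTheory.Polynomial.Quotient
import Mathlib.Algebra.Polynomial.Lifts
import Mathlib.Algebra.Polynomial.Degree.SmallDegree
import HarnessLib

/-!
# The fibre line of a point blow-up at `τ = 1`: the closed-point dichotomy on a chart (ring level)

Topic: `Literature/AlgebraicGeometry/Resolution`. [CoP1] = Cossart–Piltant, J. Algebra 320 (2008), Lemma 4.3 (5)
and the proof of Prop. 4.4 (p. 12): `π` the blowing up of a regular threefold at a closed point `x`,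
`(y, u₁, u₂) = (c₀, c_j, c_l)` a regular system of parameters with `T_x = <Y₀>` (`τ(x) = 1`); a near point
`x′` lies on the line `{Y₀ = 0} ≅ ℙ¹_{k(x)}` of `π⁻¹(x) = ℙ(𝔪_x/𝔪_x²)`, and on the chart `u_j ≠ 0`,
`𝒪_{X′,x′} = (B_j)_𝔴` with `B_j = 𝒪_{X,x}[𝔪/c_j]`, `B_j/𝔪B_j = k[T₀, T_l]`, the prime `𝔴 ∋ e₀ = y/u_j` of the
CLOSED point `x′` (emb.dim `𝒪_{x′} = 3`) maps onto a NONZERO prime `𝔫 = (P̄)` of the principal ideal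
domain `k[T] = k[T₀, T_l]/(T₀)`, `P̄` monic irreducible; lifting `P̄` to a monic `P ∈ 𝒪_{X,x}[T]`:

  `𝔴 = (c_j, e₀, P(e_l))`, `𝔪_{x′} = (u_j, y/u_j, P(u_l/u_j))`, and `G(u_l/u_j) ∈ 𝔪_{x′} ⟺ P̄ ∣ Ḡ`.

Either `deg P̄ = 1` — `x′` is `k(x)`-RATIONAL, `P = T − a`, `𝔪_{x′} = (y/u_j, u_j, u_l/u_j − a)` and
`k(x) → k(x′)` is onto ([CoP1] p. 12: "`x′ = (0:1:0)` or `(0:1:λ)`") — or `deg P̄ ≥ 2` (the non-rational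
closed points of the line; [CoP1] p. 12 L8–13: "`P(y/L(u₁,u₂), u₂/u₁)`, `P ∈ k(x)[A, B]` irreducible
homogeneous"). This file is the RING-LEVEL engine (`pointCentre_chart_dichotomy`), for any chart
presentation `χ : B_j → R′` of a local ring `R′` with `spanFinrank 𝔪′ = 3`; the scheme-level trichotomy
of the point step is assembled from it in `PointStepTrichotomy.lean`.

* `sub_rename_kill_mem_span_X` — `m ≡ (re-embedding of m(T₀ := 0)) (mod T₀)` in `k[T₀, T_l]`;
* `exists_monic_irreducible_eq_span` — a nonzero prime of `k[T]` is `(P̄)`, `P̄` monic irreducible;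
* `pointCentre_chart_dichotomy` — the dichotomy above.

Everything is PROVED (no `sorry`, no new definitions, no named facts). OURS rendering of a printed proof
step; F-71 / T1 are NOT proved here; no summit statement is proved. AI-written; weaker than expert review.

## Sources

* V. Cossart, O. Piltant, J. Algebra 320 (2008), Lemma 4.3 (5); proof of Prop. 4.4, p. 12. [CossartPiltant2008]
* V. Cossart, U. Jannsen, S. Saito, LNM 2270 (2020), Lemma 14.1 (the near locus over a `τ = 1`… point
  is the line `ℙ(Dir)`), Thm. 3.14. [CossartJannsenSaito2020]
* The Stacks Project, Tag 0804 (charts of a blowing up). [StacksProject]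
-/

noncomputable section

open IsLocalRing

namespace Literature.AlgebraicGeometry.Resolution

universe u

/-- Killing the variable `T₀` of `k[T_i : i ≠ j]` (`T₀ ↦ 0`, the other variables kept, read in `k[T]` when there is
one other variable): an element is congruent modulo `(T₀)` to the re-embedding of its image.
[cite: CossartPiltant2008, proof of Prop. 4.4, p. 12] -/
theorem sub_rename_kill_mem_span_X {k : Type u} [CommRing k] {j : Fin 3} (hj0 : j ≠ 0) {l : Fin 3}
    (hl : l ≠ j) (κ : MvPolynomial {i : Fin 3 // i ≠ j} k →ₐ[k] Polynomial k)
    (hκ0 : κ (MvPolynomial.X ⟨0, hj0.symm⟩) = 0) (hκl : κ (MvPolynomial.X ⟨l, hl⟩) = Polynomial.X)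
    (hι : ∀ i : {i : Fin 3 // i ≠ j}, i.1 ≠ 0 → i = ⟨l, hl⟩)
    (m : MvPolynomial {i : Fin 3 // i ≠ j} k) :
    m - Polynomial.aeval (MvPolynomial.X ⟨l, hl⟩) (κ m) ∈
      Ideal.span {(MvPolynomial.X ⟨0, hj0.symm⟩ : MvPolynomial {i : Fin 3 // i ≠ j} k)} := by
  induction m using MvPolynomial.induction_on with
  | C a =>
    rw [MvPolynomial.algHom_C, Polynomial.algebraMap_eq, Polynomial.aeval_C, MvPolynomial.algebraMap_eq, sub_self]
    exact Ideal.zero_mem _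
  | add p q hp hq =>
    rw [map_add, map_add, add_sub_add_comm]
    exact Ideal.add_mem _ hp hq
  | mul_X p i hp =>
    by_cases hi : i.1 = 0
    · have hi' : i = ⟨0, hj0.symm⟩ := Subtype.ext hi
      rw [hi', map_mul, hκ0, mul_zero, map_zero, sub_zero]
      exact Ideal.mul_mem_left _ _ (Ideal.subset_span rfl)
    · have hi' : i = ⟨l, hl⟩ := hι i hi
      rw [hi', map_mul, hκl, map_mul, Polynomial.aeval_X]
      have : p * MvPolynomial.X ⟨l, hl⟩ - Polynomial.aeval (MvPolynomial.X ⟨l, hl⟩) (κ p) * MvPolynomial.X ⟨l, hl⟩ =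
          (p - Polynomial.aeval (MvPolynomial.X ⟨l, hl⟩) (κ p)) * MvPolynomial.X ⟨l, hl⟩ := by ring
      rw [this]
      exact Ideal.mul_mem_right _ _ hp



/-- A nonzero prime ideal of `k[T]`, `k` a field, is generated by a monic irreducible polynomial.
[cite: StacksProject, Tag 00O3] -/
theorem exists_monic_irreducible_eq_span {k : Type*} [Field k] {𝔫 : Ideal (Polynomial k)}
    (hp : 𝔫.IsPrime) (h0 : 𝔫 ≠ ⊥) :
    ∃ P : Polynomial k, P.Monic ∧ Irreducible P ∧ 𝔫 = Ideal.span {P} := by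
  have hg := Ideal.span_singleton_generator 𝔫
  have hg0 : Submodule.IsPrincipal.generator 𝔫 ≠ 0 := fun h =>
    h0 (by rw [← hg]; exact Ideal.span_singleton_eq_bot.mpr h)
  have hprime : Prime (Submodule.IsPrincipal.generator 𝔫) :=
    (Ideal.span_singleton_prime hg0).mp (by rw [hg]; exact hp)
  have hu : IsUnit (Polynomial.C (Submodule.IsPrincipal.generator 𝔫).leadingCoeff⁻¹) :=
    Polynomial.isUnit_C.mpr (inv_ne_zero (Polynomial.leadingCoeff_ne_zero.mpr hg0)).isUnit
  refine ⟨Submodule.IsPrincipal.generator 𝔫 * Polynomial.C (Submodule.IsPrincipal.generator 𝔫).leadingCoeff⁻¹,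
    Polynomial.monic_mul_leadingCoeff_inv hg0,
    (associated_mul_unit_right _ _ hu).irreducible hprime.irreducible, ?_⟩
  rw [Ideal.span_singleton_mul_right_unit hu, hg]

set_option maxHeartbeats 800000 in
-- one long chart computation (as in `NearPointsPointCentreLineLocal`): many hypotheses, large terms
/-- **The closed-point dichotomy on the line `{Y₀ = 0}` of the fibre, chart `u_j ≠ 0` (ring level).**
`R` local with `𝔪 = (c₀, c₁, c₂)`, `c` quasi-regular; `{0, j, l} = {0, 1, 2}`; `χ : B_j → R′` a chart
presentation of the local ring `R′` (`χ ∘ (R → B_j) = φ`, `R′ = (B_j)_𝔴`, `𝔴 ∩ R = 𝔪`) at a prime `𝔴 ∋ e₀`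
with `spanFinrank 𝔪_{R′} = 3`. Then EITHER (rational) for some `a ∈ R`, `a = 0` or a unit,
`𝔪_{R′} = (χ e₀, φ c_j, χ e_l − φ a)` and `k(R) → k(R′)` is onto, OR (non-rational) for some monic
`P ∈ R[T]` with `P̄ ∈ k(R)[T]` irreducible of degree `≥ 2`: `G(χ e_l) ∈ 𝔪_{R′} ⟺ P̄ ∣ Ḡ` for all
`G ∈ R[T]`, and `𝔪_{R′} = (χ e₀, φ c_j, P(χ e_l))`.
[cite: CossartPiltant2008, Lemma 4.3 (5); proof of Prop. 4.4, p. 12] [cite: CossartJannsenSaito2020, Lemma 14.1] -/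
theorem pointCentre_chart_dichotomy {R R' : Type u} [CommRing R] [IsLocalRing R] [CommRing R']
    [IsLocalRing R'] (hd' : (maximalIdeal R').spanFinrank = 3)
    {c : Fin 3 → R} (hc : Ideal.span (Set.range c) = maximalIdeal R) (hcq : IsQuasiRegular c)
    {j l : Fin 3} (hj0 : j ≠ 0) (hl : l ≠ j) (hl0 : l ≠ 0)
    (hι : ∀ i : {i : Fin 3 // i ≠ j}, i.1 ≠ 0 → i = ⟨l, hl⟩)
    (φ : R →+* R') [IsLocalHom φ] (𝔴 : Ideal (chartRing c j)) [𝔴.IsPrime]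
    (χ : chartRing c j →+* R') (hχ : ∀ a, χ (chartBase c j a) = φ a)
    (hloc : @IsLocalization.AtPrime _ _ R' _ χ.toAlgebra 𝔴 _)
    (h𝔴 : 𝔴.comap (chartBase c j) = maximalIdeal R) (he0 : chartGen c j 0 ∈ 𝔴) :
    (∃ a : R, (a = 0 ∨ IsUnit a) ∧
        Ideal.span {χ (chartGen c j 0), φ (c j), χ (chartGen c j l) - φ a} = maximalIdeal R' ∧
        Function.Surjective (ResidueField.map φ)) ∨
    (∃ P : Polynomial R, P.Monic ∧ 2 ≤ (P.map (residue R)).natDegree ∧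
        Irreducible (P.map (residue R)) ∧
        (∀ G : Polynomial R, Polynomial.eval₂ φ (χ (chartGen c j l)) G ∈ maximalIdeal R' ↔
          P.map (residue R) ∣ G.map (residue R)) ∧
        Ideal.span {χ (chartGen c j 0), φ (c j), Polynomial.eval₂ φ (χ (chartGen c j l)) P} =
          maximalIdeal R') := by
  classical
  letI := χ.toAlgebra
  haveI : IsLocalization.AtPrime R' 𝔴 := hloc
  have hcm : ∀ i, c i ∈ maximalIdeal R := fun i => hc ▸ Ideal.subset_span ⟨i, rfl⟩
  have h𝔴' : (maximalIdeal R).map (chartBase c j) ≤ 𝔴 := by rw [← h𝔴]; exact Ideal.map_comap_le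
  have hmB : (maximalIdeal R).map (chartBase c j) = Ideal.span {chartBase c j (c j)} := by
    rw [← hc]; exact Ideal.map_span_range_eq_span_singleton _ c j _ (reesChartBase_apply_eq_mul_chartGen c j)
  have hcj𝔴 : chartBase c j (c j) ∈ 𝔴 := h𝔴' (Ideal.mem_map_of_mem _ (hcm j))
  have hχm : ∀ b, χ b ∈ maximalIdeal R' ↔ b ∈ 𝔴 := fun b =>
    IsLocalization.AtPrime.to_map_mem_maximal_iff R' 𝔴 b
  have h𝔪' : maximalIdeal R' = 𝔴.map χ := (IsLocalization.AtPrime.map_eq_maximalIdeal 𝔴 R').symm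
  -- STEP 1: the fibre chart `ρ : B_j → k[T_i : i ≠ j]` and the line map `θ : B_j → k[T]`
  obtain ⟨ρ, hρsurj, hρker, hρF⟩ :
      ∃ ρ : chartRing c j →+* MvPolynomial {i : Fin 3 // i ≠ j} (ResidueField R),
        Function.Surjective ρ ∧ RingHom.ker ρ = (maximalIdeal R).map (chartBase c j) ∧
        ∀ F : MvPolynomial (Fin 3) R,
          ρ (MvPolynomial.eval₂Hom (chartBase c j) (fun i => chartGen c j i) F) =
            MvPolynomial.map (residue R) (dehomogenize j F) :=
    exists_chartResidueMap c j hcq hcm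
  let κ : MvPolynomial {i : Fin 3 // i ≠ j} (ResidueField R) →ₐ[ResidueField R]
      Polynomial (ResidueField R) :=
    MvPolynomial.aeval fun i => if i.1 = 0 then 0 else Polynomial.X
  have hκ0 : κ (MvPolynomial.X ⟨0, hj0.symm⟩) = 0 := by simp [κ]
  have hκl : κ (MvPolynomial.X ⟨l, hl⟩) = Polynomial.X := by simp [κ, hl0]
  have hκC : ∀ a, κ (MvPolynomial.C a) = Polynomial.C a := fun a => by
    rw [MvPolynomial.algHom_C, Polynomial.algebraMap_eq]
  let θ : chartRing c j →+* Polynomial (ResidueField R) := κ.toRingHom.comp ρ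
  have hρC : ∀ r, ρ (chartBase c j r) = MvPolynomial.C (residue R r) := fun r => by
    have h := hρF (MvPolynomial.C r)
    rw [MvPolynomial.coe_eval₂Hom, MvPolynomial.eval₂_C, MvPolynomial.algHom_C, MvPolynomial.algebraMap_eq,
      MvPolynomial.map_C] at h
    exact h
  have hρX : ∀ (i : Fin 3) (hi : i ≠ j), ρ (chartGen c j i) = MvPolynomial.X ⟨i, hi⟩ := fun i hi => by
    have h := hρF (MvPolynomial.X i)
    rw [MvPolynomial.coe_eval₂Hom, MvPolynomial.eval₂_X] at h
    rw [h, MvPolynomial.aeval_X, killVar_of_ne j hi, MvPolynomial.map_X]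
  have hθC : ∀ r, θ (chartBase c j r) = Polynomial.C (residue R r) := fun r => by
    show κ (ρ (chartBase c j r)) = _
    rw [hρC, hκC]
  have hθl : θ (chartGen c j l) = Polynomial.X := by
    show κ (ρ (chartGen c j l)) = _
    rw [hρX l hl, hκl]
  have hθG : ∀ G : Polynomial R,
      θ (Polynomial.eval₂ (chartBase c j) (chartGen c j l) G) = G.map (residue R) := fun G => by
    rw [Polynomial.hom_eval₂, hθl]
    have : θ.comp (chartBase c j) = Polynomial.C.comp (residue R) := RingHom.ext hθC
    rw [this, ← Polynomial.eval₂_map, Polynomial.eval₂_C_X]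
  have hθsurj : Function.Surjective θ := by
    intro q
    obtain ⟨G, hG⟩ := Polynomial.map_surjective (residue R) residue_surjective q
    exact ⟨Polynomial.eval₂ (chartBase c j) (chartGen c j l) G, by rw [hθG, hG]⟩
  -- `ker θ ⊆ (c_j, e₀) ⊆ 𝔴`
  have hkerθ : ∀ b, θ b = 0 → b ∈ Ideal.span {chartBase c j (c j), chartGen c j 0} := by
    intro b hb
    have h1 := sub_rename_kill_mem_span_X hj0 hl κ hκ0 hκl hι (ρ b)
    have hb' : κ (ρ b) = 0 := hb
    rw [hb', map_zero, sub_zero] at h1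
    have hmap : Ideal.span {(MvPolynomial.X ⟨0, hj0.symm⟩ :
        MvPolynomial {i : Fin 3 // i ≠ j} (ResidueField R))} = (Ideal.span {chartGen c j 0}).map ρ := by
      rw [Ideal.map_span, Set.image_singleton, hρX 0 hj0.symm]
    rw [hmap] at h1
    have h2 : b ∈ ((Ideal.span {chartGen c j 0}).map ρ).comap ρ := Ideal.mem_comap.mpr h1
    rw [Ideal.comap_map_of_surjective ρ hρsurj, ← RingHom.ker_eq_comap_bot, hρker, hmB] at h2
    rw [Ideal.span_insert, sup_comm]
    exact h2
  have hspan𝔴 : Ideal.span {chartBase c j (c j), chartGen c j 0} ≤ 𝔴 := by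
    rw [Ideal.span_le, Set.insert_subset_iff, Set.singleton_subset_iff]
    exact ⟨hcj𝔴, he0⟩
  have hker𝔴 : RingHom.ker θ ≤ 𝔴 := fun b hb => hspan𝔴 (hkerθ b hb)
  -- STEP 2: the image prime `𝔫 = θ(𝔴)` of `k[T]` is nonzero (emb.dim `R′ = 3`), `= (P̄)`
  have h𝔴eq : (𝔴.map θ).comap θ = 𝔴 := by
    rw [Ideal.comap_map_of_surjective θ hθsurj, ← RingHom.ker_eq_comap_bot]
    exact sup_eq_left.mpr hker𝔴
  haveI h𝔫p : (𝔴.map θ).IsPrime := Ideal.map_isPrime_of_surjective hθsurj hker𝔴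
  have h𝔫0 : 𝔴.map θ ≠ ⊥ := by
    intro h0
    have h1 : 𝔴 ≤ Ideal.span {chartBase c j (c j), chartGen c j 0} := fun b hb => hkerθ b (by
      have hb' : θ b ∈ 𝔴.map θ := Ideal.mem_map_of_mem _ hb
      rwa [h0, Ideal.mem_bot] at hb')
    have h2 : maximalIdeal R' = Ideal.span {φ (c j), χ (chartGen c j 0)} := by
      refine le_antisymm ?_ ?_
      · rw [h𝔪']
        refine (Ideal.map_mono h1).trans (le_of_eq ?_)
        rw [Ideal.map_span, Set.image_insert_eq, Set.image_singleton, hχ]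
      · rw [Ideal.span_le, Set.insert_subset_iff, Set.singleton_subset_iff, SetLike.mem_coe,
          SetLike.mem_coe, ← hχ, hχm, hχm]
        exact ⟨hcj𝔴, he0⟩
    have h3 := Submodule.spanFinrank_span_le_ncard_of_finite (R := R') (M := R')
      ((Set.finite_singleton (χ (chartGen c j 0))).insert (φ (c j)))
    have h4 : ({φ (c j), χ (chartGen c j 0)} : Set R').ncard ≤ 2 :=
      (Set.ncard_insert_le _ _).trans (by rw [Set.ncard_singleton])
    have h5 : (maximalIdeal R').spanFinrank ≤ 2 := by rw [h2]; exact h3.trans h4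
    omega
  obtain ⟨Pb, hPbm, hPbi, h𝔫⟩ := exists_monic_irreducible_eq_span h𝔫p h𝔫0
  have hmem : ∀ b, b ∈ 𝔴 ↔ Pb ∣ θ b := fun b => by
    rw [← h𝔴eq, Ideal.mem_comap, h𝔫, Ideal.mem_span_singleton]
  -- STEP 3: for any lift `P` of `P̄`: `𝔪′ = (χ e₀, φ c_j, P(χ e_l))` and the residue criterion
  have hχP : ∀ G : Polynomial R, χ (Polynomial.eval₂ (chartBase c j) (chartGen c j l) G) =
      Polynomial.eval₂ φ (χ (chartGen c j l)) G := fun G => by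
    rw [Polynomial.hom_eval₂, show χ.comp (chartBase c j) = φ from RingHom.ext hχ]
  have hcrit : ∀ G : Polynomial R, Polynomial.eval₂ φ (χ (chartGen c j l)) G ∈ maximalIdeal R' ↔
      Pb ∣ G.map (residue R) := fun G => by
    rw [← hχP, hχm, hmem, hθG]
  have key : ∀ P : Polynomial R, P.map (residue R) = Pb →
      Ideal.span {χ (chartGen c j 0), φ (c j), Polynomial.eval₂ φ (χ (chartGen c j l)) P} =
        maximalIdeal R' := by
    intro P hP
    have hPe : Polynomial.eval₂ (chartBase c j) (chartGen c j l) P ∈ 𝔴 := by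
      rw [hmem, hθG, hP]
    have h𝔴gen : 𝔴 = Ideal.span {chartBase c j (c j), chartGen c j 0,
        Polynomial.eval₂ (chartBase c j) (chartGen c j l) P} := by
      refine le_antisymm (fun b hb => ?_) ?_
      · obtain ⟨q, hq⟩ := (hmem b).mp hb
        obtain ⟨b₂, rfl⟩ := hθsurj q
        have h1 : θ (b - Polynomial.eval₂ (chartBase c j) (chartGen c j l) P * b₂) = 0 := by
          rw [map_sub θ b (Polynomial.eval₂ (chartBase c j) (chartGen c j l) P * b₂),
            map_mul θ (Polynomial.eval₂ (chartBase c j) (chartGen c j l) P) b₂, hθG, hP, hq, sub_self]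
        have h2 : b - Polynomial.eval₂ (chartBase c j) (chartGen c j l) P * b₂ ∈
            Ideal.span {chartBase c j (c j), chartGen c j 0,
              Polynomial.eval₂ (chartBase c j) (chartGen c j l) P} :=
          Ideal.span_mono (Set.insert_subset_insert (Set.singleton_subset_iff.mpr
            (Set.mem_insert _ _))) (hkerθ _ h1)
        have h3 : Polynomial.eval₂ (chartBase c j) (chartGen c j l) P * b₂ ∈
            Ideal.span {chartBase c j (c j), chartGen c j 0,
              Polynomial.eval₂ (chartBase c j) (chartGen c j l) P} :=
          Ideal.mul_mem_right _ _ (Ideal.subset_span (Set.mem_insert_of_mem _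
            (Set.mem_insert_of_mem _ (Set.mem_singleton _))))
        have h4 := Ideal.add_mem _ h2 h3
        rwa [sub_add_cancel b (Polynomial.eval₂ (chartBase c j) (chartGen c j l) P * b₂)] at h4
      · rw [Ideal.span_le, Set.insert_subset_iff, Set.insert_subset_iff, Set.singleton_subset_iff]
        exact ⟨hcj𝔴, he0, hPe⟩
    rw [h𝔪', h𝔴gen, Ideal.map_span, Set.image_insert_eq, Set.image_insert_eq, Set.image_singleton, hχ,
      hχP, Set.insert_comm]
  -- STEP 4: `deg P̄ = 1` (rational) or `deg P̄ ≥ 2` (non-rational)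
  have hdeg1 : 1 ≤ Pb.natDegree :=
    Polynomial.natDegree_pos_iff_degree_pos.mpr (Polynomial.degree_pos_of_irreducible hPbi)
  by_cases hdeg : Pb.natDegree = 1
  · have hPb : Pb = Polynomial.X + Polynomial.C (Pb.coeff 0) := hPbm.eq_X_add_C hdeg
    obtain ⟨a, ha, hres⟩ : ∃ a : R, (a = 0 ∨ IsUnit a) ∧ residue R a = -Pb.coeff 0 := by
      by_cases h0 : Pb.coeff 0 = 0
      · exact ⟨0, Or.inl rfl, by rw [map_zero, h0, neg_zero]⟩
      · obtain ⟨a, ha⟩ := residue_surjective (R := R) (-Pb.coeff 0)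
        refine ⟨a, Or.inr ((residue_ne_zero_iff_isUnit a).mp ?_), ha⟩
        rw [ha]; exact neg_ne_zero.mpr h0
    have hPb' : Pb = Polynomial.X - Polynomial.C (residue R a) := by
      rw [hres, map_neg, sub_neg_eq_add]; exact hPb
    have hP : (Polynomial.X - Polynomial.C a).map (residue R) = Pb := by
      rw [Polynomial.map_sub, Polynomial.map_X, Polynomial.map_C, ← hPb']
    have hgen := key _ hP
    rw [Polynomial.eval₂_sub, Polynomial.eval₂_X, Polynomial.eval₂_C] at hgen
    refine Or.inl ⟨a, ha, hgen, ?_⟩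
    -- `k(R) → k(R′)` is onto: `B_j/𝔴 = k(R)` and `R′ = (B_j)_𝔴`
    haveI : (𝔴.map θ).IsMaximal := IsPrime.to_maximal_ideal h𝔫0
    haveI : 𝔴.IsMaximal := by rw [← h𝔴eq]; exact Ideal.comap_isMaximal_of_surjective θ hθsurj
    have hsurj : Function.Surjective ((Ideal.Quotient.mk 𝔴).comp (chartBase c j)) := by
      intro y
      obtain ⟨b, rfl⟩ := Ideal.Quotient.mk_surjective y
      obtain ⟨r, hr⟩ := residue_surjective (R := R) ((θ b).eval (residue R a))
      refine ⟨r, ?_⟩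
      rw [RingHom.comp_apply, Ideal.Quotient.eq, hmem, map_sub θ (chartBase c j r) b, hθC, hr, hPb',
        dvd_sub_comm]
      exact Polynomial.X_sub_C_dvd_sub_C_eval
    have key2 := surjective_residue_comp_of_surjective_quotient_comp (S := R') (chartBase c j) 𝔴 hsurj
    intro z
    obtain ⟨r, hr⟩ := key2 z
    refine ⟨residue R r, ?_⟩
    rw [ResidueField.map_residue, ← hr, RingHom.comp_apply, RingHom.comp_apply, ← hχ]
    rfl
  · have hdeg2 : 2 ≤ Pb.natDegree := by omega
    obtain ⟨P, hPmap, -, hPmon⟩ := Polynomial.lifts_and_natDegree_eq_and_monic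
      ((Polynomial.mem_lifts Pb).mpr (Polynomial.map_surjective _ residue_surjective Pb)) hPbm
    refine Or.inr ⟨P, hPmon, by rw [hPmap]; exact hdeg2, by rw [hPmap]; exact hPbi,
      fun G => by rw [hPmap]; exact hcrit G, key P hPmap⟩

end Literature.AlgebraicGeometry.Resolution

end
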